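import Literature.AlgebraicGeometry.ModuliOfAbelianVarieties.SiegelModuliInterpretation
import Literature.Geometry.Kaehler.ComplexTorusMaps
import HarnessLib

/-!
# A reading of an endomorphism on the TORUS of a unit-frame marking is a reading on its RATIONAL TORSION
# ([Milne2005ShimuraVarieties] Thm. 6.11, (63); [LangeBirkenhake1992] §1.1.2)

Topic `Literature/AlgebraicGeometry/ModuliOfAbelianVarieties`; namespace `Literature.AlgebraicGeometry.ModuliOfAbelianVarieties.SiegelAdelicMarking`.
THEOREMS ONLY (no definition, no named fact, no instance, no notation, no `sorry`).  Cell `hodgecm-mathlib` (D-0151), FLOOR 0, P6 «MOD» (crux hLiu418 =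
stmt-HodgeConjecture-24832, `--supports`), E6 closer of `Cruxes/HLiu418/Lines/F0_P6a_PELWitnessE.lean`, socket Σ-GAL (A-p04 (g24) lineage since LEAD
01:36:19Z): ★ KERNEL ED. 3 `SiegelAdelicMarking.conjugate_comp_conjFibreIso_eq_of_lifts_of_hom` takes the fibre readings `hy : y (u v) = u (ℓ v)` on the
rational torsion `u = m.r : ℚ^{2g} → A(ℂ)`, while σ1 (`ReadsCReading`) + ★ H1 produce them on the torus, `y (m.toFun t) = m.toFun (ρ(M) t)`; for a UNIT
FRAME (`m.γ = 1`, the (ADM) clause of ★ P-3) the two are the same reading with `ℓ = M_ℚ`.  HC_CM is proved only modulo the printed citations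
(2 remaining named inputs hLiu418 24832, h413 24833) until rung 0 closes; this file is generic and changes no count.

* §1 (private) `r_eq_toFun_proj_of_γ_eq_one'` — unit frame: `u(v) = toFun (π v_ℝ)` (★ twin in `SiegelPairingReadOfTypeFrame`).
* §2 **`map_r_eq_of_map_toFun_mapMatrix`** — THE HEAD: torus reading by `ρ(M)` ⇒ torsion reading by `M_ℚ`.

## References
* [Milne2005ShimuraVarieties] J. S. Milne, *Introduction to Shimura Varieties* (2005; rev. 2017), §6 Thm. 6.11 pp. 74–75, §12 (63) p. 116.
* [LangeBirkenhake1992] H. Lange, Ch. Birkenhake, *Complex Abelian Varieties* (1992), §1.1.2 (analytic and rational representations).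
-/

set_option autoImplicit false

noncomputable section

open Matrix CategoryTheory
open Literature.AlgebraicGeometry.Motives (AbelianVariety AlgPoints)
open Literature.Geometry.Kaehler (ComplexTorus)
open Literature.Geometry.Kaehler.ComplexTorus (proj)

namespace Literature.AlgebraicGeometry.ModuliOfAbelianVarieties

namespace SiegelAdelicMarking

variable {g : ℕ} {δ : Fin g → ℕ} {J : C0pm δ} {a : gspFinAdelic δ} {A : AbelianVariety ℂ} (m : SiegelAdelicMarking J a A)

/-- Unit frame: `u(v) = toFun (π v_ℝ)` (private twin of ★ `SiegelAdelicMarking.r_eq_toFun_proj_of_γ_eq_one` of `SiegelPairingReadOfTypeFrame`, kept local to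
spare the import). [cite: Milne2005ShimuraVarieties, §6 Thm. 6.11 p. 74] -/
private theorem r_eq_toFun_proj_of_γ_eq_one' (hγ : m.γ = 1) (v : Fin g ⊕ Fin g → ℚ) :
    m.r v = m.toFun (proj m.Ψ fun i => (v i : ℝ)) := by
  rw [m.toFun_proj_ratCast, hγ, Units.val_one, one_mulVec]

/-- `M_ℝ v_ℝ = (M_ℚ v)_ℝ` for an integral matrix `M` and a rational vector `v` (casting plumbing). [folklore] -/
private theorem map_intCast_mulVec_ratCast (M : Matrix (Fin g ⊕ Fin g) (Fin g ⊕ Fin g) ℤ) (v : Fin g ⊕ Fin g → ℚ) :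
    (M.map (Int.cast : ℤ → ℝ)) *ᵥ (fun i => (v i : ℝ)) = fun i => (((M.map (Int.cast : ℤ → ℚ)) *ᵥ v) i : ℝ) := by
  funext i
  simp only [Matrix.mulVec, dotProduct, Matrix.map_apply, Rat.cast_sum, Rat.cast_mul, Rat.cast_intCast]

/-- **TORUS READING ⇒ TORSION READING (unit frame).**  If an endomorphism `y` of the marked abelian variety reads on the torus of a unit-frame
marking as the integral matrix `M` — `y (toFun t) = toFun (ρ(M) t)` for all `t` (the shape ★ H1 + σ1 `ReadsCReading` deliver) — then it reads on the
rational torsion as `M_ℚ`: `y (u v) = u (M_ℚ v)` for all `v ∈ ℚ^{2g}` (the `hy` binder of ★ KERNEL ED. 3).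
[cite: Milne2005ShimuraVarieties, §6 Thm. 6.11 pp. 74–75 and §12 (63) p. 116] [cite: LangeBirkenhake1992, §1.1.2] -/
theorem map_r_eq_of_map_toFun_mapMatrix (hγ : m.γ = 1) (y : A ⟶ A) (M : Matrix (Fin g ⊕ Fin g) (Fin g ⊕ Fin g) ℤ)
    (h : ∀ t : ComplexTorus m.Ψ, AlgPoints.map y.hom.hom.hom (m.toFun t) = m.toFun (ComplexTorus.mapMatrix m.Ψ m.Ψ M t))
    (v : Fin g ⊕ Fin g → ℚ) :
    AlgPoints.map y.hom.hom.hom (m.r v) = m.r ((M.map (Int.cast : ℤ → ℚ)) *ᵥ v) := by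
  rw [m.r_eq_toFun_proj_of_γ_eq_one' hγ v, h, ComplexTorus.mapMatrix_proj, map_intCast_mulVec_ratCast,
    ← m.r_eq_toFun_proj_of_γ_eq_one' hγ]

end SiegelAdelicMarking

end Literature.AlgebraicGeometry.ModuliOfAbelianVarieties

end
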